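import Mathlib
import HarnessLib
import Summits.AnomalousDissipation.AnomalousDissipation.Theses.MomentParity
import Literature.Analysis.FluidPDE.NSGalerkinTrajectory
import Literature.Analysis.FluidPDE.StatisticalSolution

/-!
# Crux MomentLadder — ideator 1 (round 1): first lemmas of the three idea cards

Scratch sketch (planner folder only). Each `def … : Prop` is the FIRST LEMMA of one crux idea
card filed under `Cruxes/MomentLadder/Ideas/`; they only need to elaborate.

* `LadderBody f nu N E ε R κ d` — the body of `MomentParity.MomentLadder` after `∀ d`, at fixed
  data (verbatim copy with `ν j ↦ nu`); `ladderBody_iff` checks it is literally that body.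
* `OrbitOccupation` — card `orbit-occupation-corner`: the occupation measure of a T-periodic
  mean-zero Galerkin trajectory of order N with period-mean energy ≤ E, period-mean dissipation
  ≥ ε, sup-norm ≤ R and a pointwise-in-time resolution schedule κ witnesses every rung of the
  ladder at (f, nu, N).
* `PlanarClassResolution` — card `planar-mixer-scalar-corner`: the crux `ResolvedDissipation`
  restricted to measures carried by x₃-invariant level-N fields and x₃-invariant forces (2-D
  Navier–Stokes + passive third component: N-uniform palinstrophy bounds at fixed viscosity).
* `EulerSqueeze` — card `casimir-squeeze-descent`: a polynomial cylindrical observable (band-limited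
  test fields of order N) whose derivative along truncated Euler `−P_N B(u,u)` is ≤ 0 on the
  mean-zero Galerkin modes of order N is a first integral there (Liouville + energy conservation).
-/

namespace Summit.AnomalousDissipation.AnomalousDissipation.Cruxes.MomentLadder.Ideate1

open MeasureTheory Filter
open scoped BigOperators

/-- The MomentLadder body after `∀ d`, at fixed `(f, nu, N, E, ε, R, κ, d)` (verbatim). -/
def LadderBody (f : UnitAddTorus (Fin 3) → EuclideanSpace ℝ (Fin 3)) (nu : ℝ) (N : ℕ) (E ε R : ℝ) (κ : ℕ → ℕ) (d : ℕ) : Prop :=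
  ∃ μ : MeasureTheory.Measure (Literature.Analysis.FunctionSpaces.Torus.energySpace (Fin 3)), MeasureTheory.IsProbabilityMeasure μ ∧ (∀ᵐ (u : Literature.Analysis.FunctionSpaces.Torus.energySpace (Fin 3)) ∂μ, (∀ k ∉ (Literature.Analysis.FunctionSpaces.Torus.freqBall N).erase (0 : Fin 3 → ℤ), UnitAddTorus.mFourierCoeff (Literature.Analysis.FunctionSpaces.EuclideanSpace.complexify ∘ (u.1 : UnitAddTorus (Fin 3) → EuclideanSpace ℝ (Fin 3))) k = 0)) ∧ (∀ᵐ u ∂μ, ‖u‖ ≤ R) ∧ (∀ n : ℕ, ∫⁻ (u : Literature.Analysis.FunctionSpaces.Torus.energySpace (Fin 3)), Literature.Analysis.FunctionSpaces.Torus.eGradNormSq (u.1 : UnitAddTorus (Fin 3) → EuclideanSpace ℝ (Fin 3)) ∂μ ≤ (∫⁻ (u : Literature.Analysis.FunctionSpaces.Torus.energySpace (Fin 3)), Literature.Analysis.FunctionSpaces.Torus.eGradNormSq (Literature.Analysis.FunctionSpaces.Torus.fourierTruncate (κ n) (u.1 : UnitAddTorus (Fin 3) → EuclideanSpace ℝ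 (Fin 3))) ∂μ) + ((n : ENNReal) + 1)⁻¹) ∧ (∀ (m : ℕ) (g : Fin m → UnitAddTorus (Fin 3) → EuclideanSpace ℝ (Fin 3)) (P : MvPolynomial (Fin m) ℝ), (∀ i, (Literature.Analysis.FunctionSpaces.Torus.IsSmooth (g i) ∧ Literature.Analysis.FunctionSpaces.Torus.IsDivFree (g i) ∧ Literature.Analysis.FunctionSpaces.Torus.HasZeroMean (g i) ∧ (∀ k ∉ (Literature.Analysis.FunctionSpaces.Torus.freqBall N).erase (0 : Fin 3 → ℤ), UnitAddTorus.mFourierCoeff (Literature.Analysis.FunctionSpaces.EuclideanSpace.complexify ∘ (g i)) k = 0))) → P.totalDegree + 1 ≤ d → MeasureTheory.Integrable (fun u => Literature.Analysis.FluidPDE.Torus.nsGeneratorPairing nu f u (fun x => ∑ i : Fin m, (MvPolynomial.eval (fun j => Literature.Analysis.FluidPDE.Torus.pairing u.1 (g j)) (MvPolynomial.pderiv i P)) • g i x)) μ ∧ ∫ u, Literature.Analysis.FluidPDE.Torus.nsGeneratorPairing nu f u (fun x => ∑ i : Fin m, (MvPolynomial.eval (fun j => Literature.Analysis.FluidPDE.Torus.pairing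 u.1 (g j)) (MvPolynomial.pderiv i P)) • g i x) ∂μ = 0) ∧ Literature.Analysis.FluidPDE.Torus.ensembleEnergy μ ≤ E ∧ ε ≤ Literature.Analysis.FluidPDE.Torus.ensembleDissipation nu μ

/-- Sanity: `MomentLadder` is literally `∃ f …, ∀ j, ∃ R κ, ∃ᶠ N, ∀ d, LadderBody f (ν j) N E ε R κ d`. -/
theorem momentLadder_iff :
    Summit.AnomalousDissipation.AnomalousDissipation.Theses.MomentParity.MomentLadder ↔
      ∃ f : UnitAddTorus (Fin 3) → EuclideanSpace ℝ (Fin 3), Literature.Analysis.FunctionSpaces.Torus.IsSmooth f ∧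
        Literature.Analysis.FunctionSpaces.Torus.IsDivFree f ∧
        Literature.Analysis.FunctionSpaces.Torus.HasZeroMean f ∧
        ∃ (ν : ℕ → ℝ) (E ε : ℝ), (∀ j, 0 < ν j) ∧ Filter.Tendsto ν Filter.atTop (nhds 0) ∧ 0 < ε ∧
          ∀ j : ℕ, ∃ (R : ℝ) (κ : ℕ → ℕ), ∃ᶠ N in Filter.atTop, ∀ d : ℕ, LadderBody f (ν j) N E ε R κ d :=
  Iff.rfl

/-- FIRST LEMMA of card `orbit-occupation-corner`. -/
def OrbitOccupation : Prop :=
  ∀ (f : UnitAddTorus (Fin 3) → EuclideanSpace ℝ (Fin 3)) (nu : ℝ) (N : ℕ) (T E ε R : ℝ) (κ : ℕ → ℕ) (U : ℝ → UnitAddTorus (Fin 3) → EuclideanSpace ℝ (Fin 3)),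
    0 < nu → 0 < T →
    Literature.Analysis.FluidPDE.Torus.IsGalerkinTrajectory nu f N U →
    (∀ t, 0 ≤ t → U (t + T) = U t) →
    (∀ t, 0 ≤ t → Literature.Analysis.FunctionSpaces.Torus.HasZeroMean (U t)) →
    T⁻¹ * (∫ t in (0 : ℝ)..T, ∫ x, ‖U t x‖ ^ 2) ≤ E →
    ε ≤ T⁻¹ * (∫ t in (0 : ℝ)..T, nu * Literature.Analysis.FunctionSpaces.Torus.gradNormSq (U t)) →
    (∀ t, 0 ≤ t → (∫ x, ‖U t x‖ ^ 2) ≤ R ^ 2) →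
    (∀ (n : ℕ) (t : ℝ), 0 ≤ t →
      Literature.Analysis.FunctionSpaces.Torus.eGradNormSq (U t) ≤
        Literature.Analysis.FunctionSpaces.Torus.eGradNormSq
            (Literature.Analysis.FunctionSpaces.Torus.fourierTruncate (κ n) (U t)) + ((n : ENNReal) + 1)⁻¹) →
    0 ≤ R → ∀ d : ℕ, LadderBody f nu N E ε R κ d

/-- FIRST LEMMA of card `planar-mixer-scalar-corner`: `ResolvedDissipation` in the x₃-invariant class. -/
def PlanarClassResolution : Prop :=
  ∀ f : UnitAddTorus (Fin 3) → EuclideanSpace ℝ (Fin 3), Literature.Analysis.FunctionSpaces.Torus.IsSmooth f → Literature.Analysis.FunctionSpaces.Torus.IsDivFree f → Literature.Analysis.FunctionSpaces.Torus.HasZeroMean f → (∀ k : Fin 3 → ℤ, k 2 ≠ 0 → UnitAddTorus.mFourierCoeff (Literature.Analysis.FunctionSpaces.EuclideanSpace.complexify ∘ f) k = 0) → ∀ ν : ℝ, 0 < ν → ∀ R : ℝ, ∃ κ : ℕ → ℕ, ∀ (N : ℕ) (μ : MeasureTheory.Measure (Literature.Analysis.FunctionSpaces.Torus.energySpace (Fin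 3))), MeasureTheory.IsProbabilityMeasure μ → (∀ᵐ (u : Literature.Analysis.FunctionSpaces.Torus.energySpace (Fin 3)) ∂μ, (∀ k ∉ (Literature.Analysis.FunctionSpaces.Torus.freqBall N).erase (0 : Fin 3 → ℤ), UnitAddTorus.mFourierCoeff (Literature.Analysis.FunctionSpaces.EuclideanSpace.complexify ∘ (u.1 : UnitAddTorus (Fin 3) → EuclideanSpace ℝ (Fin 3))) k = 0)) → (∀ᵐ (u : Literature.Analysis.FunctionSpaces.Torus.energySpace (Fin 3)) ∂μ, (∀ k : Fin 3 → ℤ, k 2 ≠ 0 → UnitAddTorus.mFourierCoeff (Literature.Analysis.FunctionSpaces.EuclideanSpace.complexify ∘ (u.1 : UnitAddTorus (Fin 3) → EuclideanSpace ℝ (Fin 3))) k = 0)) → (∀ᵐ u ∂μ, ‖u‖ ≤ R) → (∀ (m : ℕ) (g : Fin m → UnitAddTorus (Fin 3) → EuclideanSpace ℝ (Fin 3)) (P : MvPolynomial (Fin m) ℝ), (∀ i, (Literature.Analysis.FunctionSpaces.Torus.IsSmooth (g i) ∧ Literature.Analysis.FunctionSpaces.Torus.IsDivFree (g i) ∧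 Literature.Analysis.FunctionSpaces.Torus.HasZeroMean (g i) ∧ (∀ k ∉ (Literature.Analysis.FunctionSpaces.Torus.freqBall N).erase (0 : Fin 3 → ℤ), UnitAddTorus.mFourierCoeff (Literature.Analysis.FunctionSpaces.EuclideanSpace.complexify ∘ (g i)) k = 0))) → MeasureTheory.Integrable (fun u => Literature.Analysis.FluidPDE.Torus.nsGeneratorPairing ν f u (fun x => ∑ i : Fin m, (MvPolynomial.eval (fun j => Literature.Analysis.FluidPDE.Torus.pairing u.1 (g j)) (MvPolynomial.pderiv i P)) • g i x)) μ ∧ ∫ u, Literature.Analysis.FluidPDE.Torus.nsGeneratorPairing ν f u (fun x => ∑ i : Fin m, (MvPolynomial.eval (fun j => Literature.Analysis.FluidPDE.Torus.pairing u.1 (g j)) (MvPolynomial.pderiv i P)) • g i x) ∂μ = 0) → ∀ n : ℕ, ∫⁻ (u : Literature.Analysis.FunctionSpaces.Torus.energySpace (Fin 3)), Literature.Analysis.FunctionSpaces.Torus.eGradNormSq (u.1 : UnitAddTorus (Fin 3) → EuclideanSpace ℝ (Fin 3)) ∂μ ≤ (∫⁻ (u : Literature.Analysis.FunctionSpaces.Torus.energySpace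 (Fin 3)), Literature.Analysis.FunctionSpaces.Torus.eGradNormSq (Literature.Analysis.FunctionSpaces.Torus.fourierTruncate (κ n) (u.1 : UnitAddTorus (Fin 3) → EuclideanSpace ℝ (Fin 3))) ∂μ) + ((n : ENNReal) + 1)⁻¹

/-- FIRST LEMMA of card `casimir-squeeze-descent`: sign-semidefinite Euler derivative ⇒ first integral. -/
def EulerSqueeze : Prop :=
  ∀ (N m : ℕ) (g : Fin m → UnitAddTorus (Fin 3) → EuclideanSpace ℝ (Fin 3)) (P : MvPolynomial (Fin m) ℝ),
    (∀ i, (Literature.Analysis.FunctionSpaces.Torus.IsSmooth (g i) ∧ Literature.Analysis.FunctionSpaces.Torus.IsDivFree (g i) ∧ Literature.Analysis.FunctionSpaces.Torus.HasZeroMean (g i) ∧ (∀ k ∉ (Literature.Analysis.FunctionSpaces.Torus.freqBall N).erase (0 : Fin 3 → ℤ), UnitAddTorus.mFourierCoeff (Literature.Analysis.FunctionSpaces.EuclideanSpace.complexify ∘ (g i)) k = 0))) →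
    (∀ u : UnitAddTorus (Fin 3) → EuclideanSpace ℝ (Fin 3), Literature.Analysis.FluidPDE.IsGalerkinMode N u →
      Literature.Analysis.FunctionSpaces.Torus.HasZeroMean u → (∫ x, inner ℝ (u x) (Literature.Analysis.FunctionSpaces.Torus.convect u (fun y => ∑ i : Fin m, (MvPolynomial.eval (fun j => ∫ z, inner ℝ (u z) (g j z)) (MvPolynomial.pderiv i P)) • g i y) x)) ≤ 0) →
    ∀ u : UnitAddTorus (Fin 3) → EuclideanSpace ℝ (Fin 3), Literature.Analysis.FluidPDE.IsGalerkinMode N u →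
      Literature.Analysis.FunctionSpaces.Torus.HasZeroMean u → (∫ x, inner ℝ (u x) (Literature.Analysis.FunctionSpaces.Torus.convect u (fun y => ∑ i : Fin m, (MvPolynomial.eval (fun j => ∫ z, inner ℝ (u z) (g j z)) (MvPolynomial.pderiv i P)) • g i y) x)) = 0

end Summit.AnomalousDissipation.AnomalousDissipation.Cruxes.MomentLadder.Ideate1
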